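/-
Copyright: the b2b-balaban T⁴-continuum CRUX team, row NE7b OWNER lineage `t4-ne7b-p1` (gen 137). Project licence.
-/
import Summits.QuantumFields.BalabanUV.T4Continuum.Spine.NE7b.SupTiltedPoincare
import Summits.QuantumFields.BalabanUV.T4Continuum.Spine.NE7b.SupBlockTiltedGradientMoments

/-!
# CONCENTRATION OF THE INPUT'S GRADIENT UNDER THE TILTED LAW — THE FOURTH CENTRED MOMENT IS UNIFORM, the class-closure plan, item (d).
# For a `C²` block input `U` (`‖U″‖ ≤ κ₂`, secant lower letter `λ` on all sites, `λ < m`) and a direction `h`, the observable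
# `A(ω) = U′(ω+ψ)[h]` is `κ₂‖h‖`-Lipschitz in `ω` (`D_ωA = U″(ω+ψ)[·,h]`), so (422)'s Poincaré inequality for the tilted law
# `ν_ψ = Z⁻¹e^{−U(ω+ψ)}dN(0,M⁻¹)` gives, at EVERY background `ψ` and UNIFORMLY in `ψ` and in the volume,
#   `Var_ν(A) ≤ κ₂²‖h‖²∕(m−λ)`   and — Poincaré once more, on `(A − E_νA)²` —   `E_ν(A − E_νA)⁴ ≤ 5κ₂⁴‖h‖⁴∕(m−λ)²`:
# the raw tilted moments of (407) grow like `e^{O(Σ_Yψ²)}`, the CENTRED ones do not.  This is the input of the uniform third-order letter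
# `κ₃⁺` of the output (successor file) (row NE7b, node U5c; (407)∕(422) BY NAME; [folklore] + [cite: BrascampLieb1976, Thm 4.1] through (422))

Cell `pub-balaban`, sub-cell `t4`, spine estimate NE7b (`T4WeightBudget.RelWeightBound`; the cell's OWN estimate — NOT PRINTED in
[Bałaban 1983–89], NOT PROVED).  Crux-route work under `Spine/NE7b/` by the row OWNER (`t4-ne7b-p1` gen 137, file (423)) under FREEZE
(0)'s crux-prover clause (this gen's class-closure audit, item (d)); NOTHING of Bałaban's is named as a Lean object, valued or asserted; no
`T4Continuum/Support` leaf typed; no `def`, no notation; zero `sorry`.  Imports (BY NAME): the OWNER's (422) `…SupTiltedPoincare`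
(`tilted_poincare`), (407) `…SupBlockTiltedGradientMoments` (`block_moment_pointwise`) and through them (405) (`lin_le_exp`), (399)
(`neg_block_le`, `integrable_exp_neg_block`), (400) (`integrable_weighted_blockDeriv_apply`), (292) (`sum_add_sq_le`), (288)
(`integrable_exp_half_sq_on`), (313) (`mul_opBound_le_of_le`).

WHAT IS PROVED ([folklore]):
* §1 `pow4_le_exp`, `block_moment4_pointwise`, `integrable_block_moments` (`e^{−U}‖U′‖ᵏ` integrable for `k = 1, 2, 4` at every `ψ`);
* §2 `hasFDerivAt_blockObservable` (`D_ω(U′(ω+ψ)h) = U″(ω+ψ)[·,h]`, norm `≤ κ₂‖h‖`), `tilted_variance_eq` (`Z⁻¹∫e(A−μ)² = Z⁻¹∫eA² − μ²`),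
  **`block_tilted_variance_le`** (`Var_ν(A) ≤ κ₂²‖h‖²∕(m−λ)`);
* §3 THE END **`block_tilted_fourth_moment_le`** (`Z⁻¹∫e^{−U}(A − μ)⁴ ≤ 5κ₂⁴‖h‖⁴∕(m−λ)²`, `μ = Z⁻¹∫e^{−U}A`); §4 toy.

HONEST (what this is NOT).  Concentration of ONE linear statistic of the gradient; the cumulant form of the third derivative and the uniform
`κ₃⁺` are the successor's; no contraction ((β4)), no decaying-covariance polymer expansion ((β3′)); scalar skeleton ((A3), NC-NE7b-α UNRULED);
nothing of Bałaban's asserted.  BY-NAME EFFECT ON THE WALL: NONE.  NE7b NOT PRINTED ∕ NOT PROVED; spine PROVED 0∕9; rung (B)+1 — the programme's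
measures remain FINITE-torus statements; NOT the mass gap, NOT Clay.  HONEST DEPENDENCY: continuum YM on T⁴ ⇐ BetaPertH ∧ nine spine estimates
(0∕9 proved); BetaPertH ⇐ (D1) ∧ (D4) ∧ CAP+tail; G-an2-4 gates asym, D1 and NE2∕3∕4.
-/

set_option autoImplicit false
set_option maxSynthPendingDepth 2

noncomputable section

namespace Summit.QuantumFields.BalabanUV.T4Continuum.NE7b.SupBlockFourthMoment

open MeasureTheory ProbabilityTheory Finset Real
open scoped BigOperators Matrix
open SupGaussianRegulator (integral_exp_half_sq_on_le integrable_exp_half_sq_on)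
open SupBlockEffectiveActionDerivative (neg_block_le integrable_exp_neg_block)
open SupBlockUpperLetter (integrable_weighted_blockDeriv_apply)
open SupRegulatedActivityShift (sum_add_sq_le)
open SupEffectiveActionDerivative (mul_opBound_le_of_le)
open SupBlockStepLineDerivatives (lin_le_exp)
open SupBlockTiltedGradientMoments (block_moment_pointwise)
open SupTiltedPoincare (tilted_poincare)

variable {ι : Type} [Fintype ι] [DecidableEq ι]

/-! ## §1. The fourth raw moment is finite -/

/-- `S⁴ ≤ (3∕2)δ⁻⁴·e^{2δS}` for `δ > 0`, `S ≥ 0` (from `x⁴∕4! ≤ eˣ`). [folklore] -/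
theorem pow4_le_exp {δ S : ℝ} (hδ : 0 < δ) (hS : 0 ≤ S) : S ^ 4 ≤ 3 / 2 * (δ ^ 4)⁻¹ * exp (2 * δ * S) := by
  have h := Real.pow_div_factorial_le_exp (x := 2 * δ * S) (by positivity) 4
  have e4 : ((Nat.factorial 4 : ℕ) : ℝ) = 24 := by norm_num [Nat.factorial]
  rw [e4] at h
  have h1 : 16 * δ ^ 4 * S ^ 4 ≤ 24 * exp (2 * δ * S) := by nlinarith [pow_nonneg hδ.le 4, pow_nonneg hS 4]
  have hd4 : 0 < δ ^ 4 := pow_pos hδ 4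
  rw [show 3 / 2 * (δ ^ 4)⁻¹ * exp (2 * δ * S) = (24 * exp (2 * δ * S)) / (16 * δ ^ 4) from by field_simp; ring]
  rw [le_div_iff₀ (by positivity)]
  nlinarith

section Main

variable {M : Matrix ι ι ℝ} {γop m lam : ℝ} {U : EuclideanSpace ℝ ι → ℝ} {U' : EuclideanSpace ℝ ι → EuclideanSpace ℝ ι →L[ℝ] ℝ}
  {U'' : EuclideanSpace ℝ ι → EuclideanSpace ℝ ι →L[ℝ] EuclideanSpace ℝ ι →L[ℝ] ℝ} {κ₀ κ₁ κ₂ a τ δ θ : ℝ}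

omit [DecidableEq ι] in
/-- **The fourth tilted-moment integrand is under the common dominator**: `e^{−U(ω+ψ)}‖U′(ω+ψ)‖⁴ ≤ K₄(ψ)·e^{½(2κ₀(1+τ)+4δ)Σ_Yω²}`,
`K₄ = κ₁⁴(8(a+2Σ_Yψ²)⁴ + 192δ⁻⁴)e^{κ₀(1+τ⁻¹)Σ_Yψ²}`. [folklore] -/
theorem block_moment4_pointwise (Y : Finset ι) (hκ₀ : 0 ≤ κ₀) (hκ₁ : 0 ≤ κ₁) (ha : 0 ≤ a) (hτ : 0 < τ) (hδ : 0 < δ)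
    (hstab : ∀ φ : EuclideanSpace ℝ ι, -(κ₀ * ∑ x ∈ Y, φ x ^ 2) ≤ U φ)
    (hU'b : ∀ φ : EuclideanSpace ℝ ι, ‖U' φ‖ ≤ κ₁ * (a + ∑ x ∈ Y, φ x ^ 2)) (ψ ω : EuclideanSpace ℝ ι) :
    exp (-U (ω + ψ)) * ‖U' (ω + ψ)‖ ^ 4 ≤ (κ₁ ^ 4 * (8 * (a + 2 * (∑ x ∈ Y, ψ x ^ 2)) ^ 4 + 192 * (δ ^ 4)⁻¹) * exp (κ₀ * (1 + τ⁻¹) * (∑ x ∈ Y, ψ x ^ 2))) * exp ((2 * κ₀ *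
        (1 + τ) + 4 * δ) * (∑ x ∈ Y, ω x ^ 2) / 2) := by
  set S : ℝ := (∑ x ∈ Y, ψ x ^ 2) with hS
  set Sω : ℝ := ∑ x ∈ Y, ω x ^ 2 with hSω
  have hS0 : 0 ≤ S := sum_nonneg fun x _ => sq_nonneg _
  have hSω0 : 0 ≤ Sω := sum_nonneg fun x _ => sq_nonneg _
  set c : ℝ := a + 2 * S with hc
  have hc0 : 0 ≤ c := by rw [hc]; positivity
  have hV : -U (ω + ψ) ≤ κ₀ * (1 + τ) * Sω + κ₀ * (1 + τ⁻¹) * S := neg_block_le Y hκ₀ hτ hstab ω ψ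
  have hsum : ∑ x ∈ Y, (ω + ψ) x ^ 2 ≤ 2 * Sω + 2 * S := by
    have h := sum_add_sq_le Y (fun x => ω x) (fun x => ψ x) one_pos
    have e : ∑ x ∈ Y, (ω + ψ) x ^ 2 = ∑ x ∈ Y, (ω x + ψ x) ^ 2 := sum_congr rfl fun x _ => by simp
    rw [e]; norm_num at h; linarith
  have hD : ‖U' (ω + ψ)‖ ≤ κ₁ * (c + 2 * Sω) := by
    refine (hU'b (ω + ψ)).trans (mul_le_mul_of_nonneg_left ?_ hκ₁)
    rw [hc]; linarith
  have hq0 : 0 ≤ c + 2 * Sω := by positivity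
  have hn4 : ‖U' (ω + ψ)‖ ^ 4 ≤ κ₁ ^ 4 * (c + 2 * Sω) ^ 4 := by
    have h := pow_le_pow_left₀ (norm_nonneg _) hD 4
    rw [mul_pow] at h; exact h
  have he1 : 1 ≤ exp (2 * δ * Sω) := one_le_exp (by positivity)
  have hq4 : (c + 2 * Sω) ^ 4 ≤ (8 * c ^ 4 + 192 * (δ ^ 4)⁻¹) * exp (2 * δ * Sω) := by
    have h1 : (c + 2 * Sω) ^ 4 ≤ 8 * c ^ 4 + 8 * (2 * Sω) ^ 4 := by
      nlinarith [sq_nonneg (c - 2 * Sω), sq_nonneg (c + 2 * Sω), sq_nonneg (c ^ 2 - (2 * Sω) ^ 2), mul_nonneg hc0 hSω0]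
    have h2 := pow4_le_exp hδ hSω0
    have h4 : c ^ 4 ≤ c ^ 4 * exp (2 * δ * Sω) := le_mul_of_one_le_right (pow_nonneg hc0 4) he1
    have e16 : (2 * Sω) ^ 4 = 16 * Sω ^ 4 := by ring
    rw [e16] at h1
    nlinarith [pow_nonneg hc0 4, (pow_pos hδ 4).le, inv_nonneg.2 (pow_pos hδ 4).le]
  have he : exp (κ₀ * (1 + τ) * Sω + κ₀ * (1 + τ⁻¹) * S) * exp (2 * δ * Sω) = exp (κ₀ * (1 + τ⁻¹) * S) * exp ((2 * κ₀ * (1 + τ) + 4 * δ) * Sω / 2) := by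
    rw [← exp_add, ← exp_add]; congr 1; ring
  calc exp (-U (ω + ψ)) * ‖U' (ω + ψ)‖ ^ 4
      ≤ exp (κ₀ * (1 + τ) * Sω + κ₀ * (1 + τ⁻¹) * S) * (κ₁ ^ 4 * ((8 * c ^ 4 + 192 * (δ ^ 4)⁻¹) * exp (2 * δ * Sω))) :=
        mul_le_mul (exp_le_exp.2 hV) (hn4.trans (mul_le_mul_of_nonneg_left hq4 (pow_nonneg hκ₁ 4))) (pow_nonneg (norm_nonneg _) 4) (exp_pos _).le
    _ = κ₁ ^ 4 * (8 * c ^ 4 + 192 * (δ ^ 4)⁻¹) * exp (κ₀ * (1 + τ⁻¹) * S) * exp ((2 * κ₀ * (1 + τ) + 4 * δ) * Sω / 2) := by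
        calc _ = κ₁ ^ 4 * (8 * c ^ 4 + 192 * (δ ^ 4)⁻¹) * (exp (κ₀ * (1 + τ) * Sω + κ₀ * (1 + τ⁻¹) * S) * exp (2 * δ * Sω)) := by ring
          _ = _ := by rw [he]; ring

/-- **The raw tilted moments of orders `1, 2, 4` are finite** at every background (domination by the Gaussian regulator (288)). [folklore] -/
theorem integrable_block_moments {Γ : Matrix ι ι ℝ} (hΓ : Γ.PosSemidef) (hΓop : (γop • (1 : Matrix ι ι ℝ) - Γ).PosSemidef) (Y : Finset ι)
    (hUd : ∀ φ : EuclideanSpace ℝ ι, HasFDerivAt U (U' φ) φ) (hU'c : Continuous U')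
    (hκ₀ : 0 ≤ κ₀) (hκ₁ : 0 ≤ κ₁) (ha : 0 ≤ a) (hτ : 0 < τ) (hδ : 0 < δ) (hθ1 : θ < 1)
    (hκθ : (2 * κ₀ * (1 + τ) + 4 * δ) * γop ≤ θ) (hstab : ∀ φ : EuclideanSpace ℝ ι, -(κ₀ * ∑ x ∈ Y, φ x ^ 2) ≤ U φ)
    (hU'b : ∀ φ : EuclideanSpace ℝ ι, ‖U' φ‖ ≤ κ₁ * (a + ∑ x ∈ Y, φ x ^ 2)) (ψ : EuclideanSpace ℝ ι) :
    Integrable (fun ω : EuclideanSpace ℝ ι => exp (-U (ω + ψ)) * ‖U' (ω + ψ)‖) (multivariateGaussian 0 Γ) ∧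
      Integrable (fun ω : EuclideanSpace ℝ ι => exp (-U (ω + ψ)) * ‖U' (ω + ψ)‖ ^ 2) (multivariateGaussian 0 Γ) ∧
      Integrable (fun ω : EuclideanSpace ℝ ι => exp (-U (ω + ψ)) * ‖U' (ω + ψ)‖ ^ 4) (multivariateGaussian 0 Γ) := by
  have hUc : Continuous U := continuous_iff_continuousAt.2 fun φ => (hUd φ).continuousAt
  have hsh : Continuous fun ω : EuclideanSpace ℝ ι => ω + ψ := continuous_id.add continuous_const
  have hEc : Continuous fun ω : EuclideanSpace ℝ ι => exp (-U (ω + ψ)) := continuous_exp.comp ((hUc.comp hsh).neg)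
  have hNc : Continuous fun ω : EuclideanSpace ℝ ι => ‖U' (ω + ψ)‖ := continuous_norm.comp (hU'c.comp hsh)
  have hdom := integrable_exp_half_sq_on hΓ hΓop (show 0 ≤ 2 * κ₀ * (1 + τ) + 4 * δ by positivity) hθ1 hκθ Y
  have key : ∀ (k : ℕ) (Kc : ℝ), (∀ ω : EuclideanSpace ℝ ι, exp (-U (ω + ψ)) * ‖U' (ω + ψ)‖ ^ k ≤ Kc * exp ((2 * κ₀ * (1 + τ) + 4 * δ) * (∑ x ∈ Y, ω x ^ 2) / 2)) →
      Integrable (fun ω : EuclideanSpace ℝ ι => exp (-U (ω + ψ)) * ‖U' (ω + ψ)‖ ^ k) (multivariateGaussian 0 Γ) := fun k Kc hb =>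
    (hdom.const_mul Kc).mono' ((hEc.mul (hNc.pow k)).aestronglyMeasurable) (ae_of_all _ fun ω => by
      rw [Real.norm_eq_abs, abs_of_nonneg (mul_nonneg (exp_pos _).le (pow_nonneg (norm_nonneg _) k))]; exact hb ω)
  have hpw := fun ω => block_moment_pointwise Y hκ₀ hκ₁ ha hτ hδ hstab hU'b ψ le_rfl ω
  have k1 := key 1 _ (fun ω => by rw [pow_one]; exact (hpw ω).1)
  simp only [pow_one] at k1
  exact ⟨k1, key 2 _ (fun ω => (hpw ω).2.1), key 4 _ (fun ω => block_moment4_pointwise Y hκ₀ hκ₁ ha hτ hδ hstab hU'b ψ ω)⟩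

/-! ## §2. The observable `A = U′(ω+ψ)h`: Lipschitz, its tilted variance -/

omit [DecidableEq ι] in
/-- **`D_ω(U′(ω+ψ)[h]) = U″(ω+ψ)[·,h]`**, a continuous map of `ω`, of norm `≤ κ₂‖h‖`. [folklore] -/
theorem hasFDerivAt_blockObservable (hU'd : ∀ φ : EuclideanSpace ℝ ι, HasFDerivAt U' (U'' φ) φ) (hU''c : Continuous U'')
    (hU''b : ∀ φ : EuclideanSpace ℝ ι, ‖U'' φ‖ ≤ κ₂) (ψ h : EuclideanSpace ℝ ι) :
    (∀ ω : EuclideanSpace ℝ ι, HasFDerivAt (fun ω : EuclideanSpace ℝ ι => U' (ω + ψ) h) ((U'' (ω + ψ)).flip h) ω) ∧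
      Continuous (fun ω : EuclideanSpace ℝ ι => (U'' (ω + ψ)).flip h) ∧ ∀ ω : EuclideanSpace ℝ ι, ‖(U'' (ω + ψ)).flip h‖ ≤ κ₂ * ‖h‖ := by
  have hsh : ∀ ω : EuclideanSpace ℝ ι, HasFDerivAt (fun ω : EuclideanSpace ℝ ι => ω + ψ) (ContinuousLinearMap.id ℝ (EuclideanSpace ℝ ι)) ω :=
    fun ω => (hasFDerivAt_id ω).add_const ψ
  refine ⟨fun ω => ?_, ?_, fun ω => ?_⟩
  · have h1 : HasFDerivAt (fun ω : EuclideanSpace ℝ ι => U' (ω + ψ)) (U'' (ω + ψ)) ω := by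
      have h := (hU'd (ω + ψ)).comp ω (hsh ω); rw [ContinuousLinearMap.comp_id] at h; exact h
    have h2 := h1.clm_apply (hasFDerivAt_const h ω)
    rw [ContinuousLinearMap.comp_zero, zero_add] at h2
    exact h2
  · exact (ContinuousLinearMap.flipₗᵢ ℝ (EuclideanSpace ℝ ι) (EuclideanSpace ℝ ι) ℝ).continuous.comp (hU''c.comp (continuous_id.add continuous_const))
      |>.clm_apply continuous_const
  · calc ‖(U'' (ω + ψ)).flip h‖ ≤ ‖(U'' (ω + ψ)).flip‖ * ‖h‖ := ContinuousLinearMap.le_opNorm _ _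
      _ ≤ κ₂ * ‖h‖ := by rw [ContinuousLinearMap.opNorm_flip]; exact mul_le_mul_of_nonneg_right (hU''b _) (norm_nonneg _)

/-- **The centred second moment is the variance**: `Z⁻¹∫e(A − μ)² = Z⁻¹∫eA² − μ²` with `μ = Z⁻¹∫eA` (linearity; `Z⁻¹∫e = 1`). [folklore] -/
theorem tilted_variance_eq (hM : M.PosDef) (hΓop : (γop • (1 : Matrix ι ι ℝ) - M⁻¹).PosSemidef) (Y : Finset ι)
    (hUd : ∀ φ : EuclideanSpace ℝ ι, HasFDerivAt U (U' φ) φ) (hU'd : ∀ φ : EuclideanSpace ℝ ι, HasFDerivAt U' (U'' φ) φ)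
    (hκ₀ : 0 ≤ κ₀) (hκ₁ : 0 ≤ κ₁) (ha : 0 ≤ a) (hτ : 0 < τ) (hδ : 0 < δ) (hθ0 : 0 < θ) (hθ1 : θ < 1)
    (hκθ : (2 * κ₀ * (1 + τ) + 4 * δ) * γop ≤ θ) (hstab : ∀ φ : EuclideanSpace ℝ ι, -(κ₀ * ∑ x ∈ Y, φ x ^ 2) ≤ U φ)
    (hU'b : ∀ φ : EuclideanSpace ℝ ι, ‖U' φ‖ ≤ κ₁ * (a + ∑ x ∈ Y, φ x ^ 2)) (ψ h : EuclideanSpace ℝ ι) :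
    (∫ ω : EuclideanSpace ℝ ι, exp (-U (ω + ψ)) ∂(multivariateGaussian 0 M⁻¹))⁻¹ * (∫ ω : EuclideanSpace ℝ ι, exp (-U (ω + ψ)) * (U' (ω + ψ) h - ((∫ ω : EuclideanSpace ℝ ι,
        exp (-U (ω + ψ)) ∂(multivariateGaussian 0 M⁻¹))⁻¹ * (∫ ω : EuclideanSpace ℝ ι, exp (-U (ω + ψ)) * U' (ω + ψ) h ∂(multivariateGaussian 0 M⁻¹)))) ^ 2
        ∂(multivariateGaussian 0 M⁻¹)) =
      (∫ ω : EuclideanSpace ℝ ι, exp (-U (ω + ψ)) ∂(multivariateGaussian 0 M⁻¹))⁻¹ * (∫ ω : EuclideanSpace ℝ ι, exp (-U (ω + ψ)) * U' (ω + ψ) h ^ 2 ∂(multivariateGaussian 0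
          M⁻¹)) - ((∫ ω : EuclideanSpace ℝ ι, exp (-U (ω + ψ)) ∂(multivariateGaussian 0 M⁻¹))⁻¹ * (∫ ω : EuclideanSpace ℝ ι, exp (-U (ω + ψ)) * U' (ω + ψ) h
          ∂(multivariateGaussian 0 M⁻¹))) ^ 2 := by
  have hΓ : (M⁻¹).PosSemidef := hM.inv.posSemidef
  have hU'c : Continuous U' := continuous_iff_continuousAt.2 fun φ => (hU'd φ).continuousAt
  have hUc : Continuous U := continuous_iff_continuousAt.2 fun φ => (hUd φ).continuousAt
  have hκθ₀ : 2 * κ₀ * (1 + τ) * γop ≤ θ := mul_opBound_le_of_le (by positivity) (by linarith) hθ0.le hκθ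
  have hI := integrable_exp_neg_block hΓ hΓop Y hUc.measurable hκ₀ hτ hθ1 hκθ₀ hstab ψ
  have hZ : 0 < (∫ ω : EuclideanSpace ℝ ι, exp (-U (ω + ψ)) ∂(multivariateGaussian 0 M⁻¹)) := integral_exp_pos hI
  obtain ⟨-, i2, -⟩ := integrable_block_moments hΓ hΓop Y hUd hU'c hκ₀ hκ₁ ha hτ hδ hθ1 hκθ hstab hU'b ψ
  have iA := integrable_weighted_blockDeriv_apply hΓ hΓop Y hUd hU'c hκ₀ hκ₁ ha hτ hδ hθ1 hκθ hstab hU'b ψ h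
  have hAc : Continuous fun ω : EuclideanSpace ℝ ι => U' (ω + ψ) h := (hU'c.comp (continuous_id.add continuous_const)).clm_apply continuous_const
  have hEc : Continuous fun ω : EuclideanSpace ℝ ι => exp (-U (ω + ψ)) := continuous_exp.comp ((hUc.comp (continuous_id.add continuous_const)).neg)
  have iA2 : Integrable (fun ω : EuclideanSpace ℝ ι => exp (-U (ω + ψ)) * U' (ω + ψ) h ^ 2) (multivariateGaussian 0 M⁻¹) :=
    (i2.const_mul (‖h‖ ^ 2)).mono' ((hEc.mul (hAc.pow 2)).aestronglyMeasurable) (ae_of_all _ fun ω => by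
      rw [Real.norm_eq_abs, abs_of_nonneg (mul_nonneg (exp_pos _).le (sq_nonneg _))]
      have hb : |U' (ω + ψ) h| ≤ ‖U' (ω + ψ)‖ * ‖h‖ := by rw [← Real.norm_eq_abs]; exact ContinuousLinearMap.le_opNorm _ _
      have hsq : U' (ω + ψ) h ^ 2 ≤ (‖U' (ω + ψ)‖ * ‖h‖) ^ 2 := by rw [← sq_abs]; exact pow_le_pow_left₀ (abs_nonneg _) hb 2
      nlinarith [exp_pos (-U (ω + ψ))])
  set μ : ℝ := ((∫ ω : EuclideanSpace ℝ ι, exp (-U (ω + ψ)) ∂(multivariateGaussian 0 M⁻¹))⁻¹ * (∫ ω : EuclideanSpace ℝ ι, exp (-U (ω + ψ)) * U' (ω + ψ) h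
      ∂(multivariateGaussian 0 M⁻¹))) with hμ
  have e1 : ∀ ω : EuclideanSpace ℝ ι, exp (-U (ω + ψ)) * (U' (ω + ψ) h - μ) ^ 2 = exp (-U (ω + ψ)) * U' (ω + ψ) h ^ 2 - 2 * μ * (exp (-U (ω + ψ)) * U' (ω + ψ) h) + μ ^ 2 *
      exp (-U (ω + ψ)) := fun ω => by ring
  simp_rw [e1]
  have iB : Integrable (fun ω : EuclideanSpace ℝ ι => exp (-U (ω + ψ)) * U' (ω + ψ) h ^ 2 - 2 * μ * (exp (-U (ω + ψ)) * U' (ω + ψ) h)) (multivariateGaussian 0 M⁻¹) :=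
      iA2.sub (iA.const_mul _)
  have iC : Integrable (fun ω : EuclideanSpace ℝ ι => μ ^ 2 * exp (-U (ω + ψ))) (multivariateGaussian 0 M⁻¹) := hI.const_mul _
  rw [integral_add iB iC, integral_sub iA2 (iA.const_mul _), integral_const_mul, integral_const_mul]
  have hZne := hZ.ne'
  rw [hμ]
  field_simp
  ring

/-- **THE TILTED VARIANCE OF `A = U′(ω+ψ)[h]` IS AT MOST `κ₂²‖h‖²∕(m−λ)`** — (422)'s Poincaré inequality on a `κ₂‖h‖`-Lipschitz
observable; UNIFORM in `ψ` and in the volume. [folklore] -/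
theorem block_tilted_variance_le (hM : M.PosDef) (hfl : ∀ z : ι → ℝ, m * ∑ i, z i ^ 2 ≤ z ⬝ᵥ (M *ᵥ z)) (hΓop : (γop • (1 : Matrix ι ι ℝ) - M⁻¹).PosSemidef) (Y : Finset ι)
    (hUd : ∀ φ : EuclideanSpace ℝ ι, HasFDerivAt U (U' φ) φ) (hU'd : ∀ φ : EuclideanSpace ℝ ι, HasFDerivAt U' (U'' φ) φ)
    (hU''c : Continuous U'') (hκ₀ : 0 ≤ κ₀) (hκ₁ : 0 ≤ κ₁) (ha : 0 ≤ a) (hτ : 0 < τ) (hδ : 0 < δ) (hθ0 : 0 < θ) (hθ1 : θ < 1)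
    (hκθ : (2 * κ₀ * (1 + τ) + 4 * δ) * γop ≤ θ) (hstab : ∀ φ : EuclideanSpace ℝ ι, -(κ₀ * ∑ x ∈ Y, φ x ^ 2) ≤ U φ)
    (hU'b : ∀ φ : EuclideanSpace ℝ ι, ‖U' φ‖ ≤ κ₁ * (a + ∑ x ∈ Y, φ x ^ 2)) (hU''b : ∀ φ : EuclideanSpace ℝ ι, ‖U'' φ‖ ≤ κ₂) (hlam : 0 ≤ lam)
    (hUsec : ∀ s : ℝ, 0 ≤ s → s ≤ 1 → ∀ a b : EuclideanSpace ℝ ι,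
      U ((1 - s) • a + s • b) - lam / 2 * (s * (1 - s)) * ∑ i, (a i - b i) ^ 2 ≤ (1 - s) * U a + s * U b)
    (hρ : lam < m) (ψ h : EuclideanSpace ℝ ι) :
    (∫ ω : EuclideanSpace ℝ ι, exp (-U (ω + ψ)) ∂(multivariateGaussian 0 M⁻¹))⁻¹ * (∫ ω : EuclideanSpace ℝ ι, exp (-U (ω + ψ)) * U' (ω + ψ) h ^ 2 ∂(multivariateGaussian 0
        M⁻¹)) - ((∫ ω : EuclideanSpace ℝ ι, exp (-U (ω + ψ)) ∂(multivariateGaussian 0 M⁻¹))⁻¹ * (∫ ω : EuclideanSpace ℝ ι, exp (-U (ω + ψ)) * U' (ω + ψ) h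
        ∂(multivariateGaussian 0 M⁻¹))) ^ 2 ≤ κ₂ ^ 2 * ‖h‖ ^ 2 / (m - lam) := by
  have hΓ : (M⁻¹).PosSemidef := hM.inv.posSemidef
  have hU'c : Continuous U' := continuous_iff_continuousAt.2 fun φ => (hU'd φ).continuousAt
  have hUc : Continuous U := continuous_iff_continuousAt.2 fun φ => (hUd φ).continuousAt
  have hκθ₀ : 2 * κ₀ * (1 + τ) * γop ≤ θ := mul_opBound_le_of_le (by positivity) (by linarith) hθ0.le hκθ
  have hI := integrable_exp_neg_block hΓ hΓop Y hUc.measurable hκ₀ hτ hθ1 hκθ₀ hstab ψ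
  have hZ : 0 < (∫ ω : EuclideanSpace ℝ ι, exp (-U (ω + ψ)) ∂(multivariateGaussian 0 M⁻¹)) := integral_exp_pos hI
  have hρ0 : 0 < m - lam := sub_pos.2 hρ
  obtain ⟨hAd, hA'c, hA'b⟩ := hasFDerivAt_blockObservable hU'd hU''c hU''b ψ h
  obtain ⟨-, i2, -⟩ := integrable_block_moments hΓ hΓop Y hUd hU'c hκ₀ hκ₁ ha hτ hδ hθ1 hκθ hstab hU'b ψ
  have iA := integrable_weighted_blockDeriv_apply hΓ hΓop Y hUd hU'c hκ₀ hκ₁ ha hτ hδ hθ1 hκθ hstab hU'b ψ h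
  have hAc : Continuous fun ω : EuclideanSpace ℝ ι => U' (ω + ψ) h := (hU'c.comp (continuous_id.add continuous_const)).clm_apply continuous_const
  have hEc : Continuous fun ω : EuclideanSpace ℝ ι => exp (-U (ω + ψ)) := continuous_exp.comp ((hUc.comp (continuous_id.add continuous_const)).neg)
  have iA2 : Integrable (fun ω : EuclideanSpace ℝ ι => exp (-U (ω + ψ)) * U' (ω + ψ) h ^ 2) (multivariateGaussian 0 M⁻¹) :=
    (i2.const_mul (‖h‖ ^ 2)).mono' ((hEc.mul (hAc.pow 2)).aestronglyMeasurable) (ae_of_all _ fun ω => by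
      rw [Real.norm_eq_abs, abs_of_nonneg (mul_nonneg (exp_pos _).le (sq_nonneg _))]
      have hb : |U' (ω + ψ) h| ≤ ‖U' (ω + ψ)‖ * ‖h‖ := by rw [← Real.norm_eq_abs]; exact ContinuousLinearMap.le_opNorm _ _
      have hsq : U' (ω + ψ) h ^ 2 ≤ (‖U' (ω + ψ)‖ * ‖h‖) ^ 2 := by rw [← sq_abs]; exact pow_le_pow_left₀ (abs_nonneg _) hb 2
      nlinarith [exp_pos (-U (ω + ψ))])
  have iD : Integrable (fun ω : EuclideanSpace ℝ ι => exp (-U (ω + ψ)) * ‖(U'' (ω + ψ)).flip h‖ ^ 2) (multivariateGaussian 0 M⁻¹) :=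
    (hI.const_mul ((κ₂ * ‖h‖) ^ 2)).mono' ((hI.aestronglyMeasurable.mul ((continuous_norm.comp hA'c).pow 2).aestronglyMeasurable))
      (ae_of_all _ fun ω => by
        rw [Real.norm_eq_abs, abs_of_nonneg (mul_nonneg (exp_pos _).le (sq_nonneg _)), mul_comm ((κ₂ * ‖h‖) ^ 2)]
        exact mul_le_mul_of_nonneg_left (pow_le_pow_left₀ (norm_nonneg _) (hA'b ω) 2) (exp_pos _).le)
  have hP := tilted_poincare hM hfl hUd hlam hUsec hρ ψ hI hAd hA'c iA iA2 iD
  -- the right side: `Z⁻¹∫e‖A′‖² ≤ κ₂²‖h‖²`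
  have hR : (∫ ω : EuclideanSpace ℝ ι, exp (-U (ω + ψ)) ∂(multivariateGaussian 0 M⁻¹))⁻¹ * (∫ ω : EuclideanSpace ℝ ι, exp (-U (ω + ψ)) * ‖(U'' (ω + ψ)).flip h‖ ^ 2
      ∂(multivariateGaussian 0 M⁻¹)) ≤ κ₂ ^ 2 * ‖h‖ ^ 2 := by
    have h1 : (∫ ω : EuclideanSpace ℝ ι, exp (-U (ω + ψ)) * ‖(U'' (ω + ψ)).flip h‖ ^ 2 ∂(multivariateGaussian 0 M⁻¹)) ≤ (∫ ω : EuclideanSpace ℝ ι, exp (-U (ω + ψ)) * (κ₂ *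
        ‖h‖) ^ 2 ∂(multivariateGaussian 0 M⁻¹)) :=
      integral_mono iD (hI.mul_const _) fun ω => mul_le_mul_of_nonneg_left (pow_le_pow_left₀ (norm_nonneg _) (hA'b ω) 2) (exp_pos _).le
    rw [integral_mul_const] at h1
    calc (∫ ω : EuclideanSpace ℝ ι, exp (-U (ω + ψ)) ∂(multivariateGaussian 0 M⁻¹))⁻¹ * (∫ ω : EuclideanSpace ℝ ι, exp (-U (ω + ψ)) * ‖(U'' (ω + ψ)).flip h‖ ^ 2
        ∂(multivariateGaussian 0 M⁻¹)) ≤ (∫ ω : EuclideanSpace ℝ ι, exp (-U (ω + ψ)) ∂(multivariateGaussian 0 M⁻¹))⁻¹ * ((∫ ω : EuclideanSpace ℝ ι, exp (-U (ω + ψ))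
        ∂(multivariateGaussian 0 M⁻¹)) * (κ₂ * ‖h‖) ^ 2) :=
          mul_le_mul_of_nonneg_left h1 (inv_nonneg.2 hZ.le)
      _ = κ₂ ^ 2 * ‖h‖ ^ 2 := by rw [← mul_assoc, inv_mul_cancel₀ hZ.ne', one_mul, mul_pow]
  calc _ ≤ (m - lam)⁻¹ * ((∫ ω : EuclideanSpace ℝ ι, exp (-U (ω + ψ)) ∂(multivariateGaussian 0 M⁻¹))⁻¹ * (∫ ω : EuclideanSpace ℝ ι, exp (-U (ω + ψ)) * ‖(U'' (ω + ψ)).flip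
      h‖ ^ 2 ∂(multivariateGaussian 0 M⁻¹))) := hP
    _ ≤ (m - lam)⁻¹ * (κ₂ ^ 2 * ‖h‖ ^ 2) := mul_le_mul_of_nonneg_left hR (inv_nonneg.2 hρ0.le)
    _ = κ₂ ^ 2 * ‖h‖ ^ 2 / (m - lam) := by rw [div_eq_inv_mul]

/-! ## §3. THE END: the fourth centred moment -/

/-- **THE FOURTH CENTRED TILTED MOMENT OF `A = U′(ω+ψ)[h]` IS AT MOST `5κ₂⁴‖h‖⁴∕(m−λ)²`** (Poincaré on `(A − μ)²`, whose `ω`-gradient is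
`2(A−μ)U″(ω+ψ)[·,h]`, plus `E(A−μ)² ≤ κ₂²‖h‖²∕(m−λ)`); UNIFORM in `ψ` and in the volume. [folklore] -/
theorem block_tilted_fourth_moment_le (hM : M.PosDef) (hfl : ∀ z : ι → ℝ, m * ∑ i, z i ^ 2 ≤ z ⬝ᵥ (M *ᵥ z)) (hΓop : (γop • (1 : Matrix ι ι ℝ) - M⁻¹).PosSemidef) (Y : Finset
    ι)
    (hUd : ∀ φ : EuclideanSpace ℝ ι, HasFDerivAt U (U' φ) φ) (hU'd : ∀ φ : EuclideanSpace ℝ ι, HasFDerivAt U' (U'' φ) φ)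
    (hU''c : Continuous U'') (hκ₀ : 0 ≤ κ₀) (hκ₁ : 0 ≤ κ₁) (ha : 0 ≤ a) (hτ : 0 < τ) (hδ : 0 < δ) (hθ0 : 0 < θ) (hθ1 : θ < 1)
    (hκθ : (2 * κ₀ * (1 + τ) + 4 * δ) * γop ≤ θ) (hstab : ∀ φ : EuclideanSpace ℝ ι, -(κ₀ * ∑ x ∈ Y, φ x ^ 2) ≤ U φ)
    (hU'b : ∀ φ : EuclideanSpace ℝ ι, ‖U' φ‖ ≤ κ₁ * (a + ∑ x ∈ Y, φ x ^ 2)) (hU''b : ∀ φ : EuclideanSpace ℝ ι, ‖U'' φ‖ ≤ κ₂) (hlam : 0 ≤ lam)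
    (hUsec : ∀ s : ℝ, 0 ≤ s → s ≤ 1 → ∀ a b : EuclideanSpace ℝ ι,
      U ((1 - s) • a + s • b) - lam / 2 * (s * (1 - s)) * ∑ i, (a i - b i) ^ 2 ≤ (1 - s) * U a + s * U b)
    (hρ : lam < m) (ψ h : EuclideanSpace ℝ ι) :
    (∫ ω : EuclideanSpace ℝ ι, exp (-U (ω + ψ)) ∂(multivariateGaussian 0 M⁻¹))⁻¹ * (∫ ω : EuclideanSpace ℝ ι, exp (-U (ω + ψ)) * (U' (ω + ψ) h - ((∫ ω : EuclideanSpace ℝ ι,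
        exp (-U (ω + ψ)) ∂(multivariateGaussian 0 M⁻¹))⁻¹ * (∫ ω : EuclideanSpace ℝ ι, exp (-U (ω + ψ)) * U' (ω + ψ) h ∂(multivariateGaussian 0 M⁻¹)))) ^ 4
        ∂(multivariateGaussian 0 M⁻¹)) ≤
      5 * (κ₂ ^ 4 * ‖h‖ ^ 4) / (m - lam) ^ 2 := by
  have hΓ : (M⁻¹).PosSemidef := hM.inv.posSemidef
  have hU'c : Continuous U' := continuous_iff_continuousAt.2 fun φ => (hU'd φ).continuousAt
  have hUc : Continuous U := continuous_iff_continuousAt.2 fun φ => (hUd φ).continuousAt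
  have hκθ₀ : 2 * κ₀ * (1 + τ) * γop ≤ θ := mul_opBound_le_of_le (by positivity) (by linarith) hθ0.le hκθ
  have hI := integrable_exp_neg_block hΓ hΓop Y hUc.measurable hκ₀ hτ hθ1 hκθ₀ hstab ψ
  have hZ : 0 < (∫ ω : EuclideanSpace ℝ ι, exp (-U (ω + ψ)) ∂(multivariateGaussian 0 M⁻¹)) := integral_exp_pos hI
  have hρ0 : 0 < m - lam := sub_pos.2 hρ
  obtain ⟨hAd, hA'c, hA'b⟩ := hasFDerivAt_blockObservable hU'd hU''c hU''b ψ h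
  obtain ⟨i1, i2, i4⟩ := integrable_block_moments hΓ hΓop Y hUd hU'c hκ₀ hκ₁ ha hτ hδ hθ1 hκθ hstab hU'b ψ
  have iA := integrable_weighted_blockDeriv_apply hΓ hΓop Y hUd hU'c hκ₀ hκ₁ ha hτ hδ hθ1 hκθ hstab hU'b ψ h
  set μ : ℝ := ((∫ ω : EuclideanSpace ℝ ι, exp (-U (ω + ψ)) ∂(multivariateGaussian 0 M⁻¹))⁻¹ * (∫ ω : EuclideanSpace ℝ ι, exp (-U (ω + ψ)) * U' (ω + ψ) h
      ∂(multivariateGaussian 0 M⁻¹))) with hμ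
  have hAc : Continuous fun ω : EuclideanSpace ℝ ι => U' (ω + ψ) h := (hU'c.comp (continuous_id.add continuous_const)).clm_apply continuous_const
  have hEc : Continuous fun ω : EuclideanSpace ℝ ι => exp (-U (ω + ψ)) := continuous_exp.comp ((hUc.comp (continuous_id.add continuous_const)).neg)
  have hb : ∀ ω : EuclideanSpace ℝ ι, |U' (ω + ψ) h| ≤ ‖U' (ω + ψ)‖ * ‖h‖ := fun ω => by
    rw [← Real.norm_eq_abs]; exact ContinuousLinearMap.le_opNorm _ _
  -- integrability of the centred powers
  have hdomk : ∀ k : ℕ, Integrable (fun ω : EuclideanSpace ℝ ι => exp (-U (ω + ψ)) * ‖U' (ω + ψ)‖ ^ k * ‖h‖ ^ k + exp (-U (ω + ψ))) (multivariateGaussian 0 M⁻¹) →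
      Integrable (fun ω : EuclideanSpace ℝ ι => exp (-U (ω + ψ)) * |U' (ω + ψ) h| ^ k) (multivariateGaussian 0 M⁻¹) := fun k hk =>
    hk.mono' ((hEc.mul ((continuous_abs.comp hAc).pow k)).aestronglyMeasurable) (ae_of_all _ fun ω => by
      rw [Real.norm_eq_abs, abs_of_nonneg (mul_nonneg (exp_pos _).le (pow_nonneg (abs_nonneg _) k))]
      have h1 : |U' (ω + ψ) h| ^ k ≤ (‖U' (ω + ψ)‖ * ‖h‖) ^ k := pow_le_pow_left₀ (abs_nonneg _) (hb ω) k
      rw [mul_pow] at h1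
      nlinarith [exp_pos (-U (ω + ψ)), mul_le_mul_of_nonneg_left h1 (exp_pos (-U (ω + ψ))).le])
  have iA2' : Integrable (fun ω : EuclideanSpace ℝ ι => exp (-U (ω + ψ)) * |U' (ω + ψ) h| ^ 2) (multivariateGaussian 0 M⁻¹) :=
    hdomk 2 (((i2.mul_const (‖h‖ ^ 2)).add hI).congr (ae_of_all _ fun ω => by simp only [Pi.add_apply]))
  have iA4' : Integrable (fun ω : EuclideanSpace ℝ ι => exp (-U (ω + ψ)) * |U' (ω + ψ) h| ^ 4) (multivariateGaussian 0 M⁻¹) :=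
    hdomk 4 (((i4.mul_const (‖h‖ ^ 4)).add hI).congr (ae_of_all _ fun ω => by simp only [Pi.add_apply]))
  have iA2 : Integrable (fun ω : EuclideanSpace ℝ ι => exp (-U (ω + ψ)) * U' (ω + ψ) h ^ 2) (multivariateGaussian 0 M⁻¹) := iA2'.congr (ae_of_all _ fun ω => by simp only
      [sq_abs])
  have iA4 : Integrable (fun ω : EuclideanSpace ℝ ι => exp (-U (ω + ψ)) * U' (ω + ψ) h ^ 4) (multivariateGaussian 0 M⁻¹) :=
    iA4'.congr (ae_of_all _ fun ω => by dsimp only; rw [← abs_pow, abs_of_nonneg (by positivity)])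
  have iA3 : Integrable (fun ω : EuclideanSpace ℝ ι => exp (-U (ω + ψ)) * U' (ω + ψ) h ^ 3) (multivariateGaussian 0 M⁻¹) :=
    (iA2'.add iA4').mono' ((hEc.mul (hAc.pow 3)).aestronglyMeasurable) (ae_of_all _ fun ω => by
      rw [Real.norm_eq_abs, abs_mul, abs_of_pos (exp_pos _), abs_pow, Pi.add_apply]
      have e0 := exp_pos (-U (ω + ψ))
      nlinarith [abs_nonneg (U' (ω + ψ) h), sq_nonneg (|U' (ω + ψ) h| ^ 2 - |U' (ω + ψ) h|), sq_nonneg (|U' (ω + ψ) h| - 1), mul_nonneg e0.le (abs_nonneg (U' (ω + ψ) h))])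
  -- the centred observable `g₂ = (A − μ)²`
  have hg2 : ∀ ω : EuclideanSpace ℝ ι, HasFDerivAt (fun ω : EuclideanSpace ℝ ι => (U' (ω + ψ) h - μ) ^ 2) ((2 * (U' (ω + ψ) h - μ)) • (U'' (ω + ψ)).flip h) ω := fun ω => by
    have h := ((hAd ω).sub_const μ).pow 2
    refine h.congr_fderiv ?_
    simp only [Nat.cast_ofNat, pow_one, Nat.add_one_sub_one, nsmul_eq_mul]
  have hg2'c : Continuous fun ω : EuclideanSpace ℝ ι => (2 * (U' (ω + ψ) h - μ)) • (U'' (ω + ψ)).flip h := (continuous_const.mul (hAc.sub continuous_const)).smul hA'c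
  -- its three integrability letters
  have e2 : ∀ ω : EuclideanSpace ℝ ι, exp (-U (ω + ψ)) * (U' (ω + ψ) h - μ) ^ 2 = exp (-U (ω + ψ)) * U' (ω + ψ) h ^ 2 - 2 * μ * (exp (-U (ω + ψ)) * U' (ω + ψ) h) + μ ^ 2 *
      exp (-U (ω + ψ)) := fun ω => by ring
  have ig2 : Integrable (fun ω : EuclideanSpace ℝ ι => exp (-U (ω + ψ)) * (U' (ω + ψ) h - μ) ^ 2) (multivariateGaussian 0 M⁻¹) := by
    simp_rw [e2]; exact (iA2.sub (iA.const_mul _)).add (hI.const_mul _)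
  have e4 : ∀ ω : EuclideanSpace ℝ ι, exp (-U (ω + ψ)) * ((U' (ω + ψ) h - μ) ^ 2) ^ 2 = exp (-U (ω + ψ)) * U' (ω + ψ) h ^ 4 - 4 * μ * (exp (-U (ω + ψ)) * U' (ω + ψ) h ^ 3)
      + 6 * μ ^ 2 * (exp (-U (ω + ψ)) * U' (ω + ψ) h ^ 2) -
      4 * μ ^ 3 * (exp (-U (ω + ψ)) * U' (ω + ψ) h) + μ ^ 4 * exp (-U (ω + ψ)) := fun ω => by ring
  have ig4 : Integrable (fun ω : EuclideanSpace ℝ ι => exp (-U (ω + ψ)) * ((U' (ω + ψ) h - μ) ^ 2) ^ 2) (multivariateGaussian 0 M⁻¹) := by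
    simp_rw [e4]; exact ((((iA4.sub (iA3.const_mul _)).add (iA2.const_mul _)).sub (iA.const_mul _)).add (hI.const_mul _))
  have igD : Integrable (fun ω : EuclideanSpace ℝ ι => exp (-U (ω + ψ)) * ‖(2 * (U' (ω + ψ) h - μ)) • (U'' (ω + ψ)).flip h‖ ^ 2) (multivariateGaussian 0 M⁻¹) := by
    refine (ig2.const_mul (4 * (κ₂ * ‖h‖) ^ 2)).mono' ((hEc.mul ((continuous_norm.comp hg2'c).pow 2)).aestronglyMeasurable)
      (ae_of_all _ fun ω => ?_)
    rw [Real.norm_eq_abs, abs_of_nonneg (mul_nonneg (exp_pos _).le (sq_nonneg _)), norm_smul, mul_pow, Real.norm_eq_abs, abs_mul,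
      abs_two, mul_pow, sq_abs]
    have h1 : ‖(U'' (ω + ψ)).flip h‖ ^ 2 ≤ (κ₂ * ‖h‖) ^ 2 := pow_le_pow_left₀ (norm_nonneg _) (hA'b ω) 2
    nlinarith [exp_pos (-U (ω + ψ)), sq_nonneg (U' (ω + ψ) h - μ), mul_nonneg (exp_pos (-U (ω + ψ))).le (sq_nonneg (U' (ω + ψ) h - μ))]
  -- Poincaré for `g₂`
  have hP := tilted_poincare hM hfl hUd hlam hUsec hρ ψ hI hg2 hg2'c ig2 ig4 igD
  -- `E g₂ = Var(A) ≤ κ₂²‖h‖²/(m−λ)`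
  have hVar := block_tilted_variance_le hM hfl hΓop Y hUd hU'd hU''c hκ₀ hκ₁ ha hτ hδ hθ0 hθ1 hκθ hstab hU'b hU''b hlam hUsec hρ ψ h
  have hEq := tilted_variance_eq hM hΓop Y hUd hU'd hκ₀ hκ₁ ha hτ hδ hθ0 hθ1 hκθ hstab hU'b ψ h
  rw [← hμ] at hVar hEq
  have hEg2 : (∫ ω : EuclideanSpace ℝ ι, exp (-U (ω + ψ)) ∂(multivariateGaussian 0 M⁻¹))⁻¹ * (∫ ω : EuclideanSpace ℝ ι, exp (-U (ω + ψ)) * (U' (ω + ψ) h - μ) ^ 2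
      ∂(multivariateGaussian 0 M⁻¹)) ≤ κ₂ ^ 2 * ‖h‖ ^ 2 / (m - lam) := by rw [hEq]; exact hVar
  have hEg2nn : 0 ≤ (∫ ω : EuclideanSpace ℝ ι, exp (-U (ω + ψ)) ∂(multivariateGaussian 0 M⁻¹))⁻¹ * (∫ ω : EuclideanSpace ℝ ι, exp (-U (ω + ψ)) * (U' (ω + ψ) h - μ) ^ 2
      ∂(multivariateGaussian 0 M⁻¹)) :=
    mul_nonneg (inv_nonneg.2 hZ.le) (integral_nonneg fun ω => mul_nonneg (exp_pos _).le (sq_nonneg _))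
  -- the right side of Poincaré: `Z⁻¹∫e‖g₂′‖² ≤ 4κ₂²‖h‖²·Z⁻¹∫e(A−μ)²`
  have hR : (∫ ω : EuclideanSpace ℝ ι, exp (-U (ω + ψ)) ∂(multivariateGaussian 0 M⁻¹))⁻¹ * (∫ ω : EuclideanSpace ℝ ι, exp (-U (ω + ψ)) * ‖(2 * (U' (ω + ψ) h - μ)) • (U'' (ω
      + ψ)).flip h‖ ^ 2 ∂(multivariateGaussian 0 M⁻¹)) ≤
      4 * (κ₂ * ‖h‖) ^ 2 * ((∫ ω : EuclideanSpace ℝ ι, exp (-U (ω + ψ)) ∂(multivariateGaussian 0 M⁻¹))⁻¹ * (∫ ω : EuclideanSpace ℝ ι, exp (-U (ω + ψ)) * (U' (ω + ψ) h - μ)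
          ^ 2 ∂(multivariateGaussian 0 M⁻¹))) := by
    have h1 : (∫ ω : EuclideanSpace ℝ ι, exp (-U (ω + ψ)) * ‖(2 * (U' (ω + ψ) h - μ)) • (U'' (ω + ψ)).flip h‖ ^ 2 ∂(multivariateGaussian 0 M⁻¹)) ≤ (∫ ω : EuclideanSpace ℝ
        ι, 4 * (κ₂ * ‖h‖) ^ 2 * (exp (-U (ω + ψ)) * (U' (ω + ψ) h - μ) ^ 2) ∂(multivariateGaussian 0 M⁻¹)) :=
      integral_mono igD (ig2.const_mul _) fun ω => by
        dsimp only
        rw [norm_smul, mul_pow, Real.norm_eq_abs, abs_mul, abs_two, mul_pow, sq_abs]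
        have h1 : ‖(U'' (ω + ψ)).flip h‖ ^ 2 ≤ (κ₂ * ‖h‖) ^ 2 := pow_le_pow_left₀ (norm_nonneg _) (hA'b ω) 2
        nlinarith [exp_pos (-U (ω + ψ)), sq_nonneg (U' (ω + ψ) h - μ), mul_nonneg (exp_pos (-U (ω + ψ))).le (sq_nonneg (U' (ω + ψ) h - μ))]
    rw [integral_const_mul] at h1
    have := mul_le_mul_of_nonneg_left h1 (inv_nonneg.2 hZ.le)
    linarith [this]
  -- assemble: `E g₂² = Var g₂ + (E g₂)² ≤ 4κ₂²‖h‖²ρ⁻¹·E g₂ + (E g₂)² ≤ 5κ₂⁴‖h‖⁴/ρ²`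
  have epow : ∀ ω : EuclideanSpace ℝ ι, exp (-U (ω + ψ)) * (U' (ω + ψ) h - μ) ^ 4 = exp (-U (ω + ψ)) * ((U' (ω + ψ) h - μ) ^ 2) ^ 2 := fun ω => by ring
  simp_rw [epow]
  set E2 : ℝ := (∫ ω : EuclideanSpace ℝ ι, exp (-U (ω + ψ)) ∂(multivariateGaussian 0 M⁻¹))⁻¹ * (∫ ω : EuclideanSpace ℝ ι, exp (-U (ω + ψ)) * (U' (ω + ψ) h - μ) ^ 2
      ∂(multivariateGaussian 0 M⁻¹)) with hE2
  set E4 : ℝ := (∫ ω : EuclideanSpace ℝ ι, exp (-U (ω + ψ)) ∂(multivariateGaussian 0 M⁻¹))⁻¹ * (∫ ω : EuclideanSpace ℝ ι, exp (-U (ω + ψ)) * ((U' (ω + ψ) h - μ) ^ 2) ^ 2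
      ∂(multivariateGaussian 0 M⁻¹)) with hE4
  have hP' : E4 - E2 ^ 2 ≤ (m - lam)⁻¹ * (4 * (κ₂ * ‖h‖) ^ 2 * E2) := hP.trans (mul_le_mul_of_nonneg_left hR (inv_nonneg.2 hρ0.le))
  have hb2 : E2 ≤ κ₂ ^ 2 * ‖h‖ ^ 2 / (m - lam) := hEg2
  have hE2sq : E2 ^ 2 ≤ (κ₂ ^ 2 * ‖h‖ ^ 2 / (m - lam)) ^ 2 := pow_le_pow_left₀ hEg2nn hb2 2
  have h4 : (m - lam)⁻¹ * (4 * (κ₂ * ‖h‖) ^ 2 * E2) ≤ 4 * (κ₂ ^ 4 * ‖h‖ ^ 4) / (m - lam) ^ 2 := by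
    rw [show 4 * (κ₂ ^ 4 * ‖h‖ ^ 4) / (m - lam) ^ 2 = (m - lam)⁻¹ * (4 * (κ₂ * ‖h‖) ^ 2 * (κ₂ ^ 2 * ‖h‖ ^ 2 / (m - lam))) from by
      field_simp]
    exact mul_le_mul_of_nonneg_left (mul_le_mul_of_nonneg_left hb2 (by positivity)) (inv_nonneg.2 hρ0.le)
  have h5 : (κ₂ ^ 2 * ‖h‖ ^ 2 / (m - lam)) ^ 2 = κ₂ ^ 4 * ‖h‖ ^ 4 / (m - lam) ^ 2 := by field_simp
  rw [h5] at hE2sq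
  have : E4 ≤ 4 * (κ₂ ^ 4 * ‖h‖ ^ 4) / (m - lam) ^ 2 + κ₂ ^ 4 * ‖h‖ ^ 4 / (m - lam) ^ 2 := by linarith
  calc E4 ≤ 4 * (κ₂ ^ 4 * ‖h‖ ^ 4) / (m - lam) ^ 2 + κ₂ ^ 4 * ‖h‖ ^ 4 / (m - lam) ^ 2 := this
    _ = 5 * (κ₂ ^ 4 * ‖h‖ ^ 4) / (m - lam) ^ 2 := by ring

end Main

/-! ## §4. Toy -/

/-- Toy (§1): `S⁴ ≤ (3∕2)·1⁻⁴·e^{2S}` at `δ = 1`. -/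
example (S : ℝ) (hS : 0 ≤ S) : S ^ 4 ≤ 3 / 2 * ((1 : ℝ) ^ 4)⁻¹ * exp (2 * 1 * S) := pow4_le_exp one_pos hS

end Summit.QuantumFields.BalabanUV.T4Continuum.NE7b.SupBlockFourthMoment
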